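import Summits.Ventures.YMGap.RobustBall.RobustAreaLawRows
import Summits.Ventures.YMGap.RobustBall.Targets
import HarnessLib

/-!
# Robust ball (Y2), area-law side, part 8 — rb-theory's TARGETS closed by name

HONEST FRAMING: venture file of the cell `pub-ymgap` (QuantumFields programme), track ROBUST-BALL.  The statement skeletons of
rb-theory's `Targets.lean` that belong to the area-law side, DISCHARGED by the theorems of parts 1–7:
`IsSlabLocalOfVertRangeTarget N (n+1) m` (centre-slab invariance derived from vertical range + gauge invariance),
`SlabCovarianceOnBall N n βt ε₀ ε₁ r m C₁ C₂` from a one-link modulus with the explicit row condition (the robust slab door), and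
`AreaLawFromSlabCovarianceTarget N n βt ε₀ ε₁ r m` (the robust Durhuus–Fröhlich assembly).  Strong-coupling finite-lattice statements;
nothing about the continuum, a mass gap, or Clay.
-/

noncomputable section

open MeasureTheory ProbabilityTheory
open Literature.MathematicalPhysics.QuantumLattice (fundamentalRep continuous_fundamentalRep fundamentalRep_apply)
open Literature.MathematicalPhysics.QuantumFieldTheory
open Literature.MathematicalPhysics.QuantumFieldTheory.DurhuusFrohlich
open Literature.MathematicalPhysics.QuantumFieldTheory.Balaban1983to89.StrongCouplingDobrushinWindow (OneLinkKRModulus)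

namespace Summit.Ventures.YMGap.RobustBall

variable {n N : ℕ}

/-- **`IsSlabLocalOfVertRangeTarget` holds** (torus dimension `n + 1`). [folklore] -/
theorem isSlabLocalOfVertRangeTarget_holds (m : ℕ) : IsSlabLocalOfVertRangeTarget N (n + 1) m :=
  fun _ _ _ hmL hW => isSlabLocal_of_hasVertRange hmL hW

/-- **`SlabCovarianceOnBall` from a one-link modulus** (the robust slab door, packaged in rb-theory's shape): with
`c = e^{ε₀}(1 + 2√N ε₁)·(2n|βt|K) + √N ε₁ ≤ 1`, `c' = max(c, 1/2)`, `r_W = max(n r, 1)`: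
`SlabCovarianceOnBall N n βt ε₀ ε₁ r m (8N/c') ((−log c')/r_W)`. [folklore] -/
theorem slabCovarianceOnBall_of_oneLinkKRModulus (hN : 1 ≤ N) (βt : ℝ) {R K : ℝ} (hK : 0 ≤ K) (hmod : OneLinkKRModulus N R K)
    (hR : |βt| * (2 * (n : ℝ)) ≤ R) {ε₀ ε₁ : ℝ} (h₁ : 0 ≤ ε₁) (r m : ℕ)
    (hc : Real.exp ε₀ * (1 + 2 * Real.sqrt N * ε₁) * (2 * (n : ℝ) * |βt| * K) + Real.sqrt N * ε₁ ≤ 1) :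
    SlabCovarianceOnBall N n βt ε₀ ε₁ r m
      (8 * N * (max (Real.exp ε₀ * (1 + 2 * Real.sqrt N * ε₁) * (2 * (n : ℝ) * |βt| * K) + Real.sqrt N * ε₁) (1 / 2))⁻¹)
      (-Real.log (max (Real.exp ε₀ * (1 + 2 * Real.sqrt N * ε₁) * (2 * (n : ℝ) * |βt| * K) + Real.sqrt N * ε₁) (1 / 2)) /
        (max (n * r) 1 : ℕ)) :=
  fun L _ W hWball hWloc v t rest x y i j k l φ ψ hφ hψ =>
    slabCovariance_of_oneLinkKRModulus hN βt hK hmod hR h₁ r m hc L W hWball hWloc v t rest x y i j k l φ ψ hφ hψ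

/-- **`AreaLawFromSlabCovarianceTarget` holds**: rb-theory's U5 assembly target, discharged by `areaLawOnBall_of_slabCovariance`
(tree coupling `N βt`). [folklore] -/
theorem areaLawFromSlabCovarianceTarget_holds (βt ε₀ ε₁ : ℝ) (r m : ℕ) : AreaLawFromSlabCovarianceTarget N n βt ε₀ ε₁ r m := by
  intro C₁ C₂ hC₂ hN hm hcov
  have hNr : (N : ℝ) ≠ 0 := by exact_mod_cast (show N ≠ 0 by omega)
  refine areaLawOnBall_of_slabCovariance (n := n) (C₁ := C₁) hN ((N : ℝ) * βt) ε₀ ε₁ r hm hC₂ ?_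
  intro L _ W hWball hWloc v t rest x y i j k l φ ψ hφ hψ
  rw [mul_div_cancel_left₀ βt hNr]
  exact hcov L W hWball hWloc v t rest x y i j k l φ ψ hφ hψ

end Summit.Ventures.YMGap.RobustBall
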